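import Literature.Computability.AlgebraicComplexity.StrassenCommutatorLowerBound
import Literature.Computability.AlgebraicComplexity.BorderRankRestriction
import HarnessLib

/-!
# Far-edge descent, kernel XXXIX-A: STRASSEN'S FLOOR for direct sums `⊕ᵢ ⟨kᵢ, mᵢ, kᵢ⟩`

Route `FarEdgeDescent`, special leaf `FiniteSaturation` (stmt-MatrixMultiplication-23739): helper
kernel, THESES-FREE (decomp-mm lens 2 «structural dichotomy: special vs generic», gen 59).  Companion
file `FarEdgeDescentStrassenFloorReadout` draws the consequences for anchored objects, bare multiples,
the dial's budget factor and the one-shot readout.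

THE QUESTION (gen-58 handoff, item 1; the critic's «only FS-grade direction»).  Every readout of the
far-edge programme feeds a border-rank certificate for a direct sum of matrix products with SYMMETRIC
OUTER FORMAT — anchored objects `⟨1,Q,1⟩ ⊕ ⊕ᵢ⟨kᵢ,mᵢ,kᵢ⟩` (the dial kernels XXXVII/XXXVIII, cost law
`r = Q + βL`, `L = ∑ kᵢmᵢ`) and bare multiples `⟨c⟩ ⊗ ⟨A,M,A⟩` (`FarEdgeDescentTower.excess_le_of_cert`)
— into the rectangular asymptotic sum inequality.  A base of MINIMAL border rank (`β = 1`: as many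
triads as `x`-variables), read out once, would give `ω(1,n,1) = n + 1` on the nose, i.e. the `∃`-witness
of `FiniteSaturation`; the dial ceiling of kernel XXXVIII (order `θ_β → ∞` as `β → 1⁺`) says nothing
there.  Is the `β = 1` endpoint inhabited by any tensor?

THE ANSWER: NO — STRASSEN'S FLOOR (`floor`, §3).  For every direct sum `⊕ᵢ ⟨kᵢ,mᵢ,kᵢ⟩` over any field
and every set `S` of blocks with `kᵢ ≥ 2`,

  `∑ᵢ kᵢmᵢ + ∑_{i∈S} mᵢ ≤ R̲(⊕ᵢ ⟨kᵢ,mᵢ,kᵢ⟩)`   (`R̲ = algBorderRank`):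

the border rank exceeds the `x`-count `L` by the full middle dimension of every genuine block; in
particular (`sum_lt_algBorderRank`) a direct sum with one genuine block is never of minimal border rank —
the symmetric-outer-format form of Coppersmith–Winograd 1982, Rem. 6.2, whose cubic case is the tree's
`sum_sq_lt_algBorderRank_matMulDirectSum`.

PROOF (§1–§3).  Re-address the `y`-variables of `D = ⊕⟨kᵢ,mᵢ,kᵢ⟩` through the swap `(i;κ,μ) ↦ (i;μ,κ)`
(`swapXY`); then the `z`-slice along a coefficient table `g` is the block matrix `⊕ᵢ g⁽ⁱ⁾ ⊗ I_{mᵢ}` on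
the `x`-variables (`slice_apply`).  The identity table gives the identity matrix (`slice_gId`), the
tables `E₁₀`, `E₀₁` of the blocks in `S` multiply block-wise (`slice_gE_mul`) with commutator
`E₁₁ − E₀₀` = the `±1` diagonal matrix on rows `0, 1` of those blocks (`slice_gE_diag`), of rank
`2∑_{i∈S} mᵢ` (`Matrix.rank_diagonal` and an explicit injection).  Strassen's equation for the border
rank, BCS Thm. (19.12) (`BCS1997_thm_19_12`: `2|X| + rk(BA⁻¹C − CA⁻¹B) ≤ 2R̲`), applied to the
three-slice restriction (`algBorderRank_slices_le`), gives the floor.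

SCOPE / HONESTY.  Strassen's theorem (19.12), its corollaries (19.13)/(19.14) for `⟨m,m,m⟩` and the
module form of (19.13) are already in the tree (`BCS1997_thm_19_12`, `BCS1997_cor_19_14`,
`BCS1997_cor_19_13_module`), as is the cubic Coppersmith–Winograd remark; mathematically the floor is the
instance "`Λ = ⊕ M_{kᵢ}(K)` acting on `⊕ K^{kᵢ×mᵢ}`, `p = E₁₀`, `q = E₀₁`" of (19.13).  New here is only
the explicit instantiation on the tree's `matMulDirectSum` declaration with the surplus `∑_{i∈S} mᵢ`
spelled out (consumed by the companion file).  No upper bound; Lickteig's sharper bounds for `⟨e,h,l⟩`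
are not formalised.  Definitions: only the bookkeeping `swapXY`, `slice`, `gId`, `gE`.

## References
* P. Bürgisser, M. Clausen, M. A. Shokrollahi, *Algebraic Complexity Theory*, Springer 1997, Thm. (19.12),
  Cor. (19.13)–(19.14), §15.13 Notes p. 457. [BurgisserClausenShokrollahi1997]
* D. Coppersmith, S. Winograd, SIAM J. Comput. 11 (1982), Rem. 6.2. [CoppersmithWinograd1982]
* M. Bläser, *Fast Matrix Multiplication*, ToC Graduate Surveys 5 (2013), Def. 6.1, §7. [Blaser2013]
* A. Conner, F. Gesmundo, J. M. Landsberg, E. Ventura, comput. complexity 31 (2022), §1.1.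
  [ConnerGesmundoLandsbergVentura2022]
-/

noncomputable section

open scoped BigOperators Matrix
open Matrix

set_option linter.dupNamespace false

namespace Summit.MatrixMultiplication.MatrixMultiplication.Theorems.FarEdgeDescentStrassenFloor

open Literature.Computability.AlgebraicComplexity

variable (K : Type) [Field K] {p : ℕ}

/-! ## §1 The `z`-slices of `⊕ᵢ ⟨kᵢ, mᵢ, kᵢ⟩` as square matrices on the `x`-variables -/

/-- Two indices of a direct-sum format `Σ i, Fin kᵢ × Fin mᵢ` are equal iff their block and their two
`ℕ`-coordinates agree. -/
theorem sigma_eq_iff {k m : Fin p → ℕ} (x y : Σ i, Fin (k i) × Fin (m i)) :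
    x = y ↔ x.1 = y.1 ∧ (x.2.1 : ℕ) = y.2.1 ∧ (x.2.2 : ℕ) = y.2.2 := by
  constructor
  · rintro rfl
    exact ⟨rfl, rfl, rfl⟩
  · rcases x with ⟨i, a, b⟩
    rcases y with ⟨j, c, d⟩
    rintro ⟨h1, h2, h3⟩
    dsimp only at h1 h2 h3
    subst h1
    have ha : a = c := Fin.ext h2
    have hb : b = d := Fin.ext h3
    subst ha hb
    rfl

/-- The swap `(i; κ, μ) ↦ (i; μ, κ)` from the `x`-variables `Σ Fin kᵢ × Fin mᵢ` of `⊕ᵢ⟨kᵢ,mᵢ,kᵢ⟩` onto its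
`y`-variables `Σ Fin mᵢ × Fin kᵢ` (the bijection realised by the "identity" `z`-slice).
[cite: BurgisserClausenShokrollahi1997, §15.13 Notes (p. 457)] -/
def swapXY (k m : Fin p → ℕ) : (Σ i, Fin (k i) × Fin (m i)) → (Σ i, Fin (m i) × Fin (k i)) :=
  fun x => ⟨x.1, (x.2.2, x.2.1)⟩

/-- The `z`-slice of `⊕ᵢ⟨kᵢ,mᵢ,kᵢ⟩` along the coefficient table `(i; κ, κ') ↦ g i κ κ'`, as a square matrix on
the `x`-variables (columns re-addressed through `swapXY`):
`slice g (x, x') = ∑_a g(a) · D(a, x, swap x')`. [cite: BurgisserClausenShokrollahi1997, Thm. (19.12)] -/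
def slice (k m : Fin p → ℕ) (g : Fin p → ℕ → ℕ → K) :
    (Σ i, Fin (k i) × Fin (m i)) → (Σ i, Fin (k i) × Fin (m i)) → K :=
  fun x x' => ∑ a : (Σ i, Fin (k i) × Fin (k i)),
    g a.1 a.2.1 a.2.2 * matMulDirectSum K k m k a x (swapXY k m x')

/-- **Entry formula**: the slice along `g` is the block matrix `⊕ᵢ g⁽ⁱ⁾ ⊗ I_{mᵢ}` —
`slice g ((i;κ,μ),(i';κ',μ')) = [i = i'] [μ = μ'] g i κ κ'`. [cite: BurgisserClausenShokrollahi1997, Thm. (19.12)] -/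
theorem slice_apply (k m : Fin p → ℕ) (g : Fin p → ℕ → ℕ → K) (x x' : Σ i, Fin (k i) × Fin (m i)) :
    slice K k m g x x' =
      if x.1 = x'.1 ∧ (x.2.2 : ℕ) = x'.2.2 then g x.1 x.2.1 x'.2.1 else 0 := by
  classical
  unfold slice
  by_cases h : x.1 = x'.1 ∧ (x.2.2 : ℕ) = x'.2.2
  · rw [if_pos h]
    have lt : (x'.2.1 : ℕ) < k x.1 := by rw [h.1]; exact x'.2.1.isLt
    rw [Finset.sum_eq_single_of_mem (⟨x.1, (x.2.1, ⟨x'.2.1, lt⟩)⟩ : Σ i, Fin (k i) × Fin (k i))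
      (Finset.mem_univ _)]
    · simp [matMulDirectSum, swapXY, h.1, h.2]
    · intro a _ hne
      have hz : matMulDirectSum K k m k a x (swapXY k m x') = 0 := by
        simp only [matMulDirectSum, swapXY, ite_eq_right_iff]
        rintro ⟨h1, -, h3, -, h5⟩
        exact absurd ((sigma_eq_iff a _).2 ⟨h1, h3, h5⟩) hne
      rw [hz, mul_zero]
  · rw [if_neg h]
    refine Finset.sum_eq_zero fun a _ => ?_
    have hz : matMulDirectSum K k m k a x (swapXY k m x') = 0 := by
      simp only [matMulDirectSum, swapXY, ite_eq_right_iff]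
      rintro ⟨-, h2, -, h4, -⟩
      exact absurd ⟨h2, h4⟩ h
    rw [hz, mul_zero]

/-- Border rank of any finite family of slices is at most that of the direct sum (restriction in the
first factor, relabelling in the third). [cite: ConnerGesmundoLandsbergVentura2022, §1.1] -/
theorem algBorderRank_slices_le (k m : Fin p → ℕ) {q : ℕ} (tab : Fin q → Fin p → ℕ → ℕ → K) :
    algBorderRank (fun j => slice K k m (tab j)) ≤ algBorderRank (matMulDirectSum K k m k) := by
  classical
  unfold slice
  exact le_trans
    (algBorderRank_restrict₁_le (fun a b c => matMulDirectSum K k m k a b (swapXY k m c))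
      (fun j (a : Σ i, Fin (k i) × Fin (k i)) => tab j a.1 a.2.1 a.2.2))
    (algBorderRank_precomp_le (matMulDirectSum K k m k) id id (swapXY k m))

/-! ## §2 The identity slice and the matrix units `E_{r s}` of selected blocks -/

/-- Coefficient table of the "identity" slice `∑ᵢ ∑_κ z⁽ⁱ⁾_{κκ}`. -/
def gId : Fin p → ℕ → ℕ → K := fun _ r s => if r = s then 1 else 0

/-- Coefficient table of the single `z`-variable `z⁽ⁱ⁾_{r s}` summed over the blocks `i ∈ S`
(the matrix unit `E_{rs}` in every selected block). -/
def gE (S : Finset (Fin p)) (r s : ℕ) : Fin p → ℕ → ℕ → K :=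
  fun i r' s' => if i ∈ S ∧ r' = r ∧ s' = s then 1 else 0

/-- The identity slice IS the identity matrix (so `⊕ᵢ⟨kᵢ,mᵢ,kᵢ⟩` is `1_X`-generic in the `z`-direction).
[cite: BurgisserClausenShokrollahi1997, §15.13 Notes (p. 457)] -/
theorem slice_gId (k m : Fin p → ℕ) : Matrix.of (slice K k m (gId K)) = 1 := by
  classical
  ext x x'
  rw [of_apply, slice_apply, one_apply]
  simp only [gId]
  by_cases hxx : x = x'
  · subst hxx
    simp
  · rw [if_neg hxx]
    split_ifs with h1 h2
    · exact absurd ((sigma_eq_iff x x').2 ⟨h1.1, h2, h1.2⟩) hxx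
    · rfl
    · rfl

/-- Entry formula of the `E_{rs}`-slice. -/
theorem slice_gE_apply (k m : Fin p → ℕ) (S : Finset (Fin p)) (r s : ℕ)
    (x x' : Σ i, Fin (k i) × Fin (m i)) :
    slice K k m (gE K S r s) x x' =
      if (x.1 = x'.1 ∧ (x.2.2 : ℕ) = x'.2.2) ∧ (x.1 ∈ S ∧ (x.2.1 : ℕ) = r ∧ (x'.2.1 : ℕ) = s)
      then 1 else 0 := by
  rw [slice_apply]
  simp only [gE]
  by_cases h : x.1 = x'.1 ∧ (x.2.2 : ℕ) = x'.2.2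
  · rw [if_pos h]
    simp only [h, true_and]
  · rw [if_neg h, if_neg (fun h' => h h'.1)]

/-- **Block-wise multiplicativity**: `E_{r s} · E_{s r'} = E_{r r'}` slice-wise, in the selected blocks
(all of which have more than `s` rows). [cite: BurgisserClausenShokrollahi1997, Thm. (19.12)] -/
theorem slice_gE_mul (k m : Fin p → ℕ) (S : Finset (Fin p)) (r s r' : ℕ) (hS : ∀ i ∈ S, s < k i) :
    Matrix.of (slice K k m (gE K S r s)) * Matrix.of (slice K k m (gE K S s r')) =
      Matrix.of (slice K k m (gE K S r r')) := by
  classical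
  ext x x''
  rw [mul_apply, of_apply, slice_gE_apply]
  simp only [of_apply, slice_gE_apply]
  by_cases H : x.1 ∈ S ∧ (x.2.1 : ℕ) = r
  · -- the unique middle index `(x.1; s, μ_x)`
    set x₀ : (Σ i, Fin (k i) × Fin (m i)) := ⟨x.1, (⟨s, hS _ H.1⟩, x.2.2)⟩ with hx₀
    rw [Finset.sum_eq_single_of_mem x₀ (Finset.mem_univ _)]
    · have h1 : ((x.1 = x₀.1 ∧ (x.2.2 : ℕ) = x₀.2.2) ∧ (x.1 ∈ S ∧ (x.2.1 : ℕ) = r ∧ (x₀.2.1 : ℕ) = s)) :=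
        ⟨⟨rfl, rfl⟩, H.1, H.2, rfl⟩
      rw [if_pos h1, one_mul]
      have e1 : x₀.1 = x.1 := rfl
      have e2 : ((x₀.2.2 : ℕ)) = x.2.2 := rfl
      have e3 : ((x₀.2.1 : ℕ)) = s := rfl
      simp only [e1, e2, e3, H.1, H.2, true_and]
    · intro y _ hne
      have hz : (if (x.1 = y.1 ∧ (x.2.2 : ℕ) = y.2.2) ∧ (x.1 ∈ S ∧ (x.2.1 : ℕ) = r ∧ (y.2.1 : ℕ) = s)
          then (1 : K) else 0) = 0 := by
        rw [ite_eq_right_iff]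
        rintro ⟨⟨h1, h2⟩, -, -, h5⟩
        exact absurd ((sigma_eq_iff y x₀).2 ⟨h1.symm, h5, h2.symm⟩) hne
      rw [hz, zero_mul]
  · have hR : ¬ ((x.1 = x''.1 ∧ (x.2.2 : ℕ) = x''.2.2) ∧ (x.1 ∈ S ∧ (x.2.1 : ℕ) = r ∧ (x''.2.1 : ℕ) = r')) :=
      fun h => H ⟨h.2.1, h.2.2.1⟩
    rw [if_neg hR]
    refine Finset.sum_eq_zero fun y _ => ?_
    have hz : (if (x.1 = y.1 ∧ (x.2.2 : ℕ) = y.2.2) ∧ (x.1 ∈ S ∧ (x.2.1 : ℕ) = r ∧ (y.2.1 : ℕ) = s)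
        then (1 : K) else 0) = 0 := by
      rw [ite_eq_right_iff]
      rintro ⟨-, h3, h4, -⟩
      exact absurd ⟨h3, h4⟩ H
    rw [hz, zero_mul]

/-- The diagonal slices `E_{rr}` are the diagonal `0/1` matrices supported on row `r` of the selected
blocks. [cite: BurgisserClausenShokrollahi1997, Thm. (19.12)] -/
theorem slice_gE_diag (k m : Fin p → ℕ) (S : Finset (Fin p)) (r : ℕ) :
    Matrix.of (slice K k m (gE K S r r)) =
      diagonal (fun x => if x.1 ∈ S ∧ (x.2.1 : ℕ) = r then (1 : K) else 0) := by
  classical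
  ext x x'
  rw [of_apply, slice_gE_apply, diagonal_apply]
  by_cases hxx : x = x'
  · subst hxx
    by_cases H : x.1 ∈ S ∧ (x.2.1 : ℕ) = r
    · rw [if_pos ⟨⟨rfl, rfl⟩, H.1, H.2, H.2⟩, if_pos rfl, if_pos H]
    · rw [if_pos rfl, if_neg H, if_neg (fun h => H ⟨h.2.1, h.2.2.1⟩)]
  · rw [if_neg hxx, ite_eq_right_iff]
    rintro ⟨⟨h1, h2⟩, -, h4, h5⟩
    exact absurd ((sigma_eq_iff x x').2 ⟨h1, h4.trans h5.symm, h2⟩) hxx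

/-! ## §3 Strassen's floor -/

/-- **STRASSEN'S FLOOR for `⊕ᵢ ⟨kᵢ, mᵢ, kᵢ⟩`.**  For every set `S` of blocks with at least two rows,
`∑ᵢ kᵢmᵢ + ∑_{i∈S} mᵢ ≤ R̲(⊕ᵢ ⟨kᵢ,mᵢ,kᵢ⟩)`: the border rank exceeds the number `L = ∑ᵢ kᵢmᵢ` of
`x`-variables by the full middle dimension of every non-trivial block.  Proof: Strassen's equation
(BCS Thm. 19.12, `R̲ ≥ L + ½ rk(B A⁻¹ C − C A⁻¹ B)`) for the `z`-slices `A = 1` (identity table),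
`B = E₁₀`, `C = E₀₁` (in the blocks of `S`): the commutator is the `±1` diagonal matrix supported on rows
`0, 1` of those blocks, of rank `2 ∑_{i∈S} mᵢ`.  (Coppersmith–Winograd 1982, Rem. 6.2 is the cubic,
qualitative case.) [cite: BurgisserClausenShokrollahi1997, Thm. (19.12)] -/
theorem floor (k m : Fin p → ℕ) (S : Finset (Fin p)) (hS : ∀ i ∈ S, 2 ≤ k i) :
    ∑ i, k i * m i + ∑ i ∈ S, m i ≤ algBorderRank (matMulDirectSum K k m k) := by
  classical
  -- the three slices: identity, `E₁₀`, `E₀₁`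
  set tab : Fin 3 → Fin p → ℕ → ℕ → K := ![gId K, gE K S 1 0, gE K S 0 1] with htab
  set t : Fin 3 → (Σ i, Fin (k i) × Fin (m i)) → (Σ i, Fin (k i) × Fin (m i)) → K :=
    fun j => slice K k m (tab j) with ht
  have hle : algBorderRank t ≤ algBorderRank (matMulDirectSum K k m k) :=
    algBorderRank_slices_le K k m tab
  have h0 : Matrix.of (t 0) = 1 := slice_gId K k m
  have h1 : t 1 = slice K k m (gE K S 1 0) := rfl
  have h2 : t 2 = slice K k m (gE K S 0 1) := rfl
  have hBCS := BCS1997_thm_19_12 t 0 1 2 (by rw [h0, det_one]; exact isUnit_one)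
  rw [h0, inv_one, Matrix.mul_one, Matrix.mul_one, h1, h2] at hBCS
  -- the commutator `E₁₀E₀₁ − E₀₁E₁₀ = E₁₁ − E₀₀`
  have hS1 : ∀ i ∈ S, 1 < k i := fun i hi => by have := hS i hi; omega
  have hS0 : ∀ i ∈ S, 0 < k i := fun i hi => by have := hS i hi; omega
  set w : (Σ i, Fin (k i) × Fin (m i)) → K := fun x =>
    (if x.1 ∈ S ∧ (x.2.1 : ℕ) = 1 then (1 : K) else 0) - (if x.1 ∈ S ∧ (x.2.1 : ℕ) = 0 then (1 : K) else 0)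
    with hw
  have hcomm : Matrix.of (slice K k m (gE K S 1 0)) * Matrix.of (slice K k m (gE K S 0 1)) -
      Matrix.of (slice K k m (gE K S 0 1)) * Matrix.of (slice K k m (gE K S 1 0)) = diagonal w := by
    rw [slice_gE_mul K k m S 1 0 1 hS0, slice_gE_mul K k m S 0 1 0 hS1, slice_gE_diag, slice_gE_diag,
      diagonal_sub]
  rw [hcomm] at hBCS
  -- rank of the commutator: at least `2 ∑_{i∈S} mᵢ` non-zero diagonal entries
  set c : Fin p → ℕ := fun i => if i ∈ S then 2 else 0 with hc
  have hck : ∀ i, c i ≤ k i := by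
    intro i
    by_cases hi : i ∈ S
    · simp only [hc, hi, if_true]; exact hS i hi
    · simp [hc, hi]
  have hcS : ∀ y : (Σ i, Fin (c i) × Fin (m i)), y.1 ∈ S := by
    intro y
    by_contra hy
    have := y.2.1.isLt
    simp [hc, hy] at this
  have hc2 : ∀ y : (Σ i, Fin (c i) × Fin (m i)), (y.2.1 : ℕ) < 2 := by
    intro y
    have := y.2.1.isLt
    simpa [hc, hcS y] using this
  have hwne : ∀ y : (Σ i, Fin (c i) × Fin (m i)),
      w ⟨y.1, (⟨y.2.1, lt_of_lt_of_le y.2.1.isLt (hck y.1)⟩, y.2.2)⟩ ≠ 0 := by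
    intro y
    have hy := hcS y
    have hlt := hc2 y
    simp only [hw, hy, true_and]
    rcases Nat.lt_succ_iff.1 hlt |> Nat.le_one_iff_eq_zero_or_eq_one.1 with h0 | h1
    · simp [h0]
    · simp [h1]
  set φ : (Σ i, Fin (c i) × Fin (m i)) → {x : (Σ i, Fin (k i) × Fin (m i)) // w x ≠ 0} :=
    fun y => ⟨⟨y.1, (⟨y.2.1, lt_of_lt_of_le y.2.1.isLt (hck y.1)⟩, y.2.2)⟩, hwne y⟩ with hφ
  have hφinj : Function.Injective φ := by
    intro y y' h
    have h' : (φ y).1 = (φ y').1 := by rw [h]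
    obtain ⟨e1, e2, e3⟩ := (sigma_eq_iff _ _).1 h'
    exact (sigma_eq_iff y y').2 ⟨e1, e2, e3⟩
  have hcard : Fintype.card (Σ i, Fin (c i) × Fin (m i)) = 2 * ∑ i ∈ S, m i := by
    simp only [Fintype.card_sigma, Fintype.card_prod, Fintype.card_fin, hc, ite_mul, zero_mul,
      Finset.mul_sum]
    exact Fintype.sum_ite_mem S (fun i => 2 * m i)
  have hsub : 2 * ∑ i ∈ S, m i ≤ (diagonal w).rank := by
    rw [Matrix.rank_diagonal, ← hcard]
    exact Fintype.card_le_of_injective φ hφinj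
  have hX : Fintype.card (Σ i, Fin (k i) × Fin (m i)) = ∑ i, k i * m i := by
    simp [Fintype.card_prod]
  omega

/-! ## §4 Strictness -/

/-- **Strictness** (the symmetric-outer-format form of Coppersmith–Winograd 1982, Rem. 6.2): a direct sum
`⊕ᵢ ⟨kᵢ,mᵢ,kᵢ⟩` with one genuine block (`kᵢ ≥ 2`, `mᵢ ≥ 1`) is NEVER of minimal border rank `∑ᵢ kᵢmᵢ`.
[cite: BurgisserClausenShokrollahi1997, §15.13 Notes (p. 457)] -/
theorem sum_lt_algBorderRank (k m : Fin p → ℕ) (h : ∃ i, 2 ≤ k i ∧ 1 ≤ m i) :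
    ∑ i, k i * m i < algBorderRank (matMulDirectSum K k m k) := by
  obtain ⟨i, hk, hm⟩ := h
  have hf := floor K k m {i} (fun j hj => by rw [Finset.mem_singleton] at hj; rw [hj]; exact hk)
  rw [Finset.sum_singleton] at hf
  omega

end Summit.MatrixMultiplication.MatrixMultiplication.Theorems.FarEdgeDescentStrassenFloor

end
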